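import Mathlib.NumberTheory.ArithmeticFunction.VonMangoldt
import Mathlib.Data.List.Prime
import Literature.NumberTheory.LFunctions.GaussianHeckeTauberian
import Literature.NumberTheory.QuadraticFields.GaussianPrimary
import HarnessLib

/-!
# The von Mangoldt function of `ℤ[i]` summed over a norm is at most `2Λ(n)`

Topic `Literature/NumberTheory/LFunctions`.  With `Λ_{ℤ[i]}(n) = ∑_{(π, j) : N(π)^j = n} log N(π)`
(`Literature.NumberTheory.LFunctions.GaussianHecke.coeffZero`, `π` over first-quadrant Gaussian primes,
`j ≥ 1`; the `n`-th coefficient of `-ζ_{ℚ(i)}'/ζ_{ℚ(i)} = P_0`) we PROVE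

* `GaussianHecke.coeffZero_le_two_mul_vonMangoldt` — **`Λ_{ℤ[i]}(n) ≤ 2 Λ(n)`** for every `n`,

the domination `|l_m(n)| ≤ Λ_{ℤ[i]}(n) ≤ 2Λ(n)` which feeds the coefficients `½ l_m(n) n^{it}` of
`-½ D_m'/D_m(s - it)` into the tree's Riesz-mean contour engine
(`Literature.NumberTheory.LFunctions.TwistedRieszMean.TwistData`, coefficients bounded by `Λ`).
Arithmetic inputs, all proved here from Mathlib's `ℤ[i]`:

* `exists_prime_dvd_and_norm_eq` — a Gaussian prime `π` divides a rational prime `p` with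
  `N(π) = p` or `N(π) = p²` (`π ∣ N(π) = π π̄`, prime factorisation of `N(π)` in `ℕ`, `N(π) ∣ N(p) = p²`
  via `Literature.NumberTheory.QuadraticFields.GaussianPrimary.norm_dvd_norm`);
* `sum_log_norm_le_of_dvd` — for the first-quadrant primes `π` dividing `p`:
  `∑_π log N(π) ≤ 2 log p` (pairwise non-associated primes dividing `p` have product dividing `p`,
  Mathlib's `Multiset.prod_primes_dvd`, and `N` is multiplicative).

## References

* E. Hecke, *Eine neue Art von Zetafunktionen …  II*, Math. Z. 6 (1920), §7 (the prime-power series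
  of `ζ(s, λ)`). [HeckeMathZ1920]
* folklore (splitting of rational primes in `ℤ[i]`: `e f g = 2`).
-/

noncomputable section

open Finset
open scoped ArithmeticFunction.vonMangoldt Classical

namespace Literature.NumberTheory.LFunctions

namespace GaussianHecke

open GaussianInt

/-! ### Norms of Gaussian primes -/

/-- `N(z)` as a natural number is `≥ 2` for a prime `z`. [folklore] -/
theorem two_le_natAbs_norm_of_prime {π : GaussianInt} (hπ : Prime π) : 2 ≤ π.norm.natAbs := by
  have := two_le_norm_of_prime hπ
  have := natAbs_norm_cast π
  omega

/-- **A Gaussian prime lies over a rational prime**: for `π` prime in `ℤ[i]` there is a rational prime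
`p` with `π ∣ p` and `N(π) = p` or `N(π) = p²`. [folklore] -/
theorem exists_prime_dvd_and_norm_eq {π : GaussianInt} (hπ : Prime π) :
    ∃ p : ℕ, p.Prime ∧ π ∣ (p : GaussianInt) ∧ (π.norm.natAbs = p ∨ π.norm.natAbs = p ^ 2) := by
  set n : ℕ := π.norm.natAbs with hndef
  have hn2 : 2 ≤ n := two_le_natAbs_norm_of_prime hπ
  have hn0 : n ≠ 0 := by omega
  -- `π ∣ n = π π̄`
  have hdvd : π ∣ (n : GaussianInt) := by
    refine ⟨star π, ?_⟩
    rw [← Zsqrtd.norm_eq_mul_conj, hndef, ← Int.cast_natCast, natAbs_norm_cast π]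
  -- prime factorisation of `n`
  have hprod : ((n.primeFactorsList.map (fun q : ℕ ↦ (q : GaussianInt))).prod) = (n : GaussianInt) := by
    rw [← Nat.cast_list_prod, Nat.prod_primeFactorsList hn0]
  rw [← hprod] at hdvd
  obtain ⟨q, hqmem, hπq⟩ := (Prime.dvd_prod_iff hπ).mp hdvd
  obtain ⟨p, hpmem, rfl⟩ := List.mem_map.mp hqmem
  have hp : p.Prime := Nat.prime_of_mem_primeFactorsList hpmem
  refine ⟨p, hp, hπq, ?_⟩
  -- `N(π) ∣ N(p) = p²`
  have hN : (n : ℤ) ∣ (p : ℤ) * p := by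
    have h := QuadraticFields.GaussianPrimary.norm_dvd_norm hπq
    rw [Zsqrtd.norm_natCast, ← natAbs_norm_cast π] at h
    exact h
  have hN' : n ∣ p ^ 2 := by rw [sq]; exact_mod_cast hN
  obtain ⟨k, hk, hnk⟩ := (Nat.dvd_prime_pow hp).mp hN'
  interval_cases k
  · rw [pow_zero] at hnk; omega
  · left; rw [hnk, pow_one]
  · right; exact hnk

/-- If `(π, j) ∈ pairsNorm n` then `n = p^k` for the rational prime `p` under `π`, with `k ≥ 1`, and
`π ∣ p`. [folklore] -/
theorem exists_prime_pow_eq_of_mem_pairsNorm {n : ℕ} {q : GaussianInt × ℕ} (hq : q ∈ pairsNorm n) :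
    ∃ p k : ℕ, p.Prime ∧ 0 < k ∧ n = p ^ k ∧ q.1 ∣ (p : GaussianInt) := by
  obtain ⟨h1, hj, hn⟩ := mem_pairsNorm.mp hq
  have hπ : Prime q.1 := (mem_primesQ1.mp h1).1
  have hj1 : 1 ≤ q.2 := (mem_Icc.mp hj).1
  obtain ⟨p, hp, hdvd, hN | hN⟩ := exists_prime_dvd_and_norm_eq hπ
  · exact ⟨p, q.2, hp, hj1, by rw [← hn, hN], hdvd⟩
  · exact ⟨p, 2 * q.2, hp, by omega, by rw [← hn, hN, pow_mul], hdvd⟩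

/-- Two prime powers `p^k = p'^k'` (`k ≥ 1`) have the same prime. [folklore] -/
theorem prime_eq_of_pow_eq {p p' k k' : ℕ} (hp : p.Prime) (hp' : p'.Prime) (hk : 0 < k)
    (h : p ^ k = p' ^ k') : p = p' := by
  have h1 : p ∣ p' ^ k' := by rw [← h]; exact dvd_pow_self p hk.ne'
  exact (Nat.prime_dvd_prime_iff_eq hp hp').mp (hp.dvd_of_dvd_pow h1)

/-! ### `∑_{π ∣ p} log N(π) ≤ 2 log p` -/

/-- `N` is multiplicative over finite products. [folklore] -/
theorem norm_prod {ι : Type*} (s : Finset ι) (f : ι → GaussianInt) :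
    (∏ i ∈ s, f i).norm = ∏ i ∈ s, (f i).norm := by
  induction s using Finset.induction_on with
  | empty => simp [Zsqrtd.norm_one]
  | insert a s ha ih => rw [prod_insert ha, prod_insert ha, Zsqrtd.norm_mul, ih]

/-- The first-quadrant Gaussian primes of norm `≤ B` dividing `z`. [folklore] -/
theorem prod_primesQ1_filter_dvd (B : ℕ) (z : GaussianInt) :
    (∏ π ∈ (primesQ1 B).filter (· ∣ z), π) ∣ z := by
  set P := (primesQ1 B).filter (· ∣ z) with hP
  have h := Multiset.prod_primes_dvd (s := P.val) z
    (fun a ha ↦ (mem_primesQ1.mp (mem_filter.mp (Finset.mem_def.mpr ha)).1).1)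
    (fun a ha ↦ (mem_filter.mp (Finset.mem_def.mpr ha)).2)
    (fun a ↦ by
      rw [Multiset.countP_eq_card_filter]
      change (P.filter (Associated a)).card ≤ 1
      refine Finset.card_le_one.mpr fun x hx y hy ↦ ?_
      obtain ⟨hx, hax⟩ := mem_filter.mp hx
      obtain ⟨hy, hay⟩ := mem_filter.mp hy
      have hxq := (mem_primesQ1.mp (mem_filter.mp hx).1).2.1
      have hyq := (mem_primesQ1.mp (mem_filter.mp hy).1).2.1
      exact eq_of_associated (hax.symm.trans hay) hxq hyq)
  simpa using h

/-- **`∑_{π ∣ p, π ∈ ℤ[i]* prime} log N(π) ≤ 2 log p`** for a rational prime `p` (the product of the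
pairwise non-associated primes dividing `p` divides `p`, so the product of their norms divides
`N(p) = p²`). [folklore] -/
theorem sum_log_norm_le_of_dvd (B : ℕ) {p : ℕ} (hp : p.Prime) :
    ∑ π ∈ (primesQ1 B).filter (· ∣ (p : GaussianInt)), Real.log (π.norm : ℝ) ≤ 2 * Real.log p := by
  set P := (primesQ1 B).filter (· ∣ (p : GaussianInt)) with hP
  have hprime : ∀ π ∈ P, Prime π := fun π hπ ↦ (mem_primesQ1.mp (mem_filter.mp hπ).1).1
  have hpos : ∀ π ∈ P, (0 : ℝ) < (π.norm : ℝ) := fun π hπ ↦ by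
    have := two_le_norm_of_prime (hprime π hπ)
    exact_mod_cast (by omega : (0 : ℤ) < π.norm)
  -- `∏ N(π) ∣ p²`
  have hdvd : (∏ π ∈ P, π) ∣ (p : GaussianInt) := prod_primesQ1_filter_dvd B (p : GaussianInt)
  have hN := QuadraticFields.GaussianPrimary.norm_dvd_norm hdvd
  rw [Zsqrtd.norm_natCast, norm_prod] at hN
  have hp0 : (0 : ℤ) < (p : ℤ) * p := by
    have := hp.pos; positivity
  have hle : (∏ π ∈ P, π.norm) ≤ (p : ℤ) * p := Int.le_of_dvd hp0 hN
  have hle' : (∏ π ∈ P, (π.norm : ℝ)) ≤ (p : ℝ) * p := by exact_mod_cast hle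
  have hprodpos : 0 < ∏ π ∈ P, (π.norm : ℝ) := prod_pos hpos
  rw [← Real.log_prod (s := P) (f := fun π ↦ (π.norm : ℝ)) (fun π hπ ↦ (hpos π hπ).ne')]
  have hp1 : (0 : ℝ) < p := by exact_mod_cast hp.pos
  calc Real.log (∏ π ∈ P, (π.norm : ℝ)) ≤ Real.log ((p : ℝ) * p) := Real.log_le_log hprodpos hle'
    _ = 2 * Real.log p := by rw [Real.log_mul hp1.ne' hp1.ne']; ring

/-! ### `Λ_{ℤ[i]}(n) ≤ 2Λ(n)` -/

/-- **The von Mangoldt function of `ℤ[i]` summed over a norm is at most twice the rational one**: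
`Λ_{ℤ[i]}(n) = ∑_{(π, j) : N(π)^j = n} log N(π) ≤ 2Λ(n)` (both vanish unless `n = p^k`; then the
first-quadrant primes `π` over `p` contribute at most once each, and `∑_{π ∣ p} log N(π) ≤ 2 log p`).
[folklore] -/
theorem coeffZero_le_two_mul_vonMangoldt (n : ℕ) : coeffZero n ≤ 2 * Λ n := by
  rcases (pairsNorm n).eq_empty_or_nonempty with h0 | ⟨q₀, hq₀⟩
  · rw [coeffZero, h0, sum_empty]
    exact mul_nonneg (by norm_num) ArithmeticFunction.vonMangoldt_nonneg
  obtain ⟨p, k, hp, hk, hn, -⟩ := exists_prime_pow_eq_of_mem_pairsNorm hq₀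
  -- `Λ(n) = log p`
  have hΛ : Λ n = Real.log p := by
    rw [hn, ArithmeticFunction.vonMangoldt_apply_pow hk.ne', ArithmeticFunction.vonMangoldt_apply_prime hp]
  -- every pair has first component dividing `p`
  have hfst : ∀ q ∈ pairsNorm n, q.1 ∈ (primesQ1 n).filter (· ∣ (p : GaussianInt)) := by
    intro q hq
    obtain ⟨p', k', hp', hk', hn', hdvd⟩ := exists_prime_pow_eq_of_mem_pairsNorm hq
    have hpp : p' = p := prime_eq_of_pow_eq hp' hp hk' (hn'.symm.trans hn)
    subst hpp
    exact mem_filter.mpr ⟨(mem_pairsNorm.mp hq).1, hdvd⟩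
  -- the first projection is injective on `pairsNorm n`
  have hinj : Set.InjOn (fun q : GaussianInt × ℕ ↦ q.1) (pairsNorm n : Set (GaussianInt × ℕ)) := by
    intro q hq q' hq' h
    obtain ⟨h1, -, hq1⟩ := mem_pairsNorm.mp (Finset.mem_coe.mp hq)
    obtain ⟨-, -, hq2⟩ := mem_pairsNorm.mp (Finset.mem_coe.mp hq')
    have h2 : 2 ≤ q.1.norm.natAbs := two_le_natAbs_norm_of_prime (mem_primesQ1.mp h1).1
    simp only at h
    have hj : q.2 = q'.2 := by
      apply Nat.pow_right_injective h2
      simp only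
      rw [hq1, h, hq2]
    exact Prod.ext h hj
  have hsum_eq : coeffZero n = ∑ π ∈ (pairsNorm n).image (fun q ↦ q.1), Real.log (π.norm : ℝ) := by
    rw [coeffZero, Finset.sum_image (f := fun π : GaussianInt ↦ Real.log (π.norm : ℝ)) hinj]
  rw [hsum_eq]
  calc ∑ π ∈ (pairsNorm n).image (fun q ↦ q.1), Real.log (π.norm : ℝ)
      ≤ ∑ π ∈ (primesQ1 n).filter (· ∣ (p : GaussianInt)), Real.log (π.norm : ℝ) := by
        refine sum_le_sum_of_subset_of_nonneg (fun π hπ ↦ ?_) (fun π hπ _ ↦ ?_)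
        · obtain ⟨q, hq, rfl⟩ := mem_image.mp hπ
          exact hfst q hq
        · have h2 := two_le_norm_of_prime (mem_primesQ1.mp (mem_filter.mp hπ).1).1
          exact Real.log_nonneg (by exact_mod_cast (by omega : (1 : ℤ) ≤ π.norm))
    _ ≤ 2 * Real.log p := sum_log_norm_le_of_dvd n hp
    _ = 2 * Λ n := by rw [hΛ]

/-- `‖l_m(n)‖ ≤ 2Λ(n)` for the coefficients of `P_m = -D_m'/D_m`. [folklore] -/
theorem norm_lCoeff_le_two_mul_vonMangoldt (m n : ℕ) : ‖lCoeff m n‖ ≤ 2 * Λ n := by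
  refine le_trans ?_ (coeffZero_le_two_mul_vonMangoldt n)
  unfold lCoeff coeffZero
  refine (norm_sum_le _ _).trans (Finset.sum_le_sum fun p hp ↦ ?_)
  rw [norm_mul, Complex.norm_real, Real.norm_of_nonneg (log_norm_nonneg_of_mem hp),
    norm_angularChar_pow_of_mem m hp, mul_one]

end GaussianHecke

end Literature.NumberTheory.LFunctions
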